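import Mathlib.LinearAlgebra.Matrix.Adjugate
import Mathlib.Analysis.Complex.Polynomial.Basic
import Mathlib.RingTheory.Polynomial.RationalRoot
import Mathlib.Analysis.Normed.Group.Basic
import Mathlib.FieldTheory.PrimitiveElement
import Mathlib.RingTheory.Norm.Transitivity
import Mathlib.RingTheory.IntegralClosure.IntegrallyClosed
import Mathlib.FieldTheory.IntermediateField.Basic
import HarnessLib

/-!
# Barrier (Schanuel) `EFunctionValuesAtAlgebraicPoints`: determinant size bounds and the Liouville lower bound — proofs only

`Literature/Barriers/Schanuel/EFunctionValuesAtAlgebraicPointsDetBounds.lean` — sibling file of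
`EFunctionValuesAtAlgebraicPoints.lean` in the programme to discharge `siegelShidlovskii_algIndep`
(Siegel–Shidlovskii; Rivoal Thm. 5.10 = Baker Thm. 11.1), support for the final rank argument
(Baker, *Transcendental Number Theory*, Ch. 11 §4, p. 113: "Plainly `D` is a non-zero algebraic
integer in `K` … it has size `≤ (r!)^{(1+16ε)(k−l)}`; hence `|D| ≫ (r!)^{-(1+16ε)(k−l)d}`. On the
other hand … expanding … we obtain `D ≪ …`"):

* `SiegelShidlovskii.norm_det_le_of_rows` — Hadamard-type bound `‖det A‖ ≤ n! ∏ₜ yₜ` for a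
  complex matrix whose `t`-th row has entries of norm `≤ yₜ` (row-sensitive, unlike Mathlib's
  `Matrix.det_le`), and `norm_adjugate_le_of_rows` for the entries of the adjugate;
* `SiegelShidlovskii.one_le_norm_mul_pow_of_isIntegral` — Liouville: for a non-zero algebraic
  integer `x` of a number field `K ⊂ ℂ` whose conjugates are `≤ B`, `1 ≤ ‖x‖ · B^{[K:ℚ]−1}` (the
  norm argument, as in `Literature.NumberTheory.Transcendental.LiouvilleLinearForms`).

All [folklore]; no named facts.

## References

* A. Baker, *Transcendental Number Theory*, CUP 1975, Ch. 11 §4 (p. 113).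
-/

noncomputable section

open Matrix Finset

namespace Literature.Barriers.Schanuel

namespace SiegelShidlovskii

/-! ### 1. Row-sensitive determinant bounds over `ℂ` -/

section Det

variable {m : Type*} [Fintype m] [DecidableEq m]

/-- **`‖det A‖ ≤ n! · ∏ₜ yₜ`** if every entry of row `t` has norm `≤ yₜ`. [folklore] -/
theorem norm_det_le_of_rows (A : Matrix m m ℂ) (y : m → ℝ)
    (h : ∀ t i, ‖A t i‖ ≤ y t) : ‖A.det‖ ≤ (Fintype.card m).factorial * ∏ t, y t := by
  rw [det_apply]
  calc ‖∑ σ : Equiv.Perm m, Equiv.Perm.sign σ • ∏ i, A (σ i) i‖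
      ≤ ∑ σ : Equiv.Perm m, ‖Equiv.Perm.sign σ • ∏ i, A (σ i) i‖ := norm_sum_le _ _
    _ ≤ ∑ _σ : Equiv.Perm m, ∏ t, y t := by
        refine sum_le_sum fun σ _ => ?_
        rw [norm_units_zsmul, norm_prod]
        calc ∏ i, ‖A (σ i) i‖ ≤ ∏ i, y (σ i) :=
              prod_le_prod (fun i _ => norm_nonneg _) fun i _ => h _ _
          _ = ∏ t, y t := Equiv.prod_comp σ y
    _ = (Fintype.card m).factorial * ∏ t, y t := by
        rw [sum_const, card_univ, Fintype.card_perm, nsmul_eq_mul]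

/-- **Adjugate entries**: `‖(adj A)ᵢⱼ‖ ≤ n! · ∏_{t ≠ j} yₜ` (row `j` is replaced by a unit
vector). [folklore] -/
theorem norm_adjugate_le_of_rows (A : Matrix m m ℂ) (y : m → ℝ)
    (h : ∀ t i, ‖A t i‖ ≤ y t) (i j : m) :
    ‖A.adjugate i j‖ ≤ (Fintype.card m).factorial * ∏ t ∈ univ.erase j, y t := by
  rw [adjugate_apply]
  have key := norm_det_le_of_rows (A.updateRow j (Pi.single i 1))
    (fun t => if t = j then 1 else y t) (fun t k => by
      by_cases ht : t = j
      · subst ht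
        rw [updateRow_self, if_pos rfl, Pi.single_apply]
        split_ifs <;> simp
      · rw [updateRow_ne ht, if_neg ht]
        exact h t k)
  refine key.trans (le_of_eq ?_)
  congr 1
  rw [← mul_prod_erase univ _ (mem_univ j), if_pos rfl, one_mul]
  exact prod_congr rfl fun t ht => by rw [if_neg (ne_of_mem_erase ht)]

end Det

/-! ### 2. The Liouville lower bound in a number field `K ⊂ ℂ` -/

/-- **Liouville's inequality (norm form).** Let `K ⊂ ℂ` be a number field, `x ∈ K` a non-zero
algebraic integer all of whose conjugates `σ(x)`, `σ : K → ℂ`, have norm `≤ B`. Then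
`1 ≤ ‖x‖ · B^{[K:ℚ]−1}` (the norm `N_{K/ℚ}(x) = ∏_σ σ(x)` is a non-zero rational integer).
[folklore] -/
theorem one_le_norm_mul_pow_of_isIntegral (K : IntermediateField ℚ ℂ) [FiniteDimensional ℚ K]
    {x : K} (hx : x ≠ 0) (hint : IsIntegral ℤ x) {B : ℝ}
    (hσ : ∀ σ : K →ₐ[ℚ] ℂ, ‖σ x‖ ≤ B) :
    1 ≤ ‖(x : ℂ)‖ * B ^ (Module.finrank ℚ K - 1) := by
  classical
  -- the norm is a non-zero rational integer
  obtain ⟨N, hN⟩ : ∃ N : ℤ, (N : ℚ) = Algebra.norm ℚ x := by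
    have hI : IsIntegral ℤ (Algebra.norm ℚ x) := Algebra.isIntegral_norm ℚ hint
    obtain ⟨N, hN⟩ := (IsIntegrallyClosed.isIntegral_iff (R := ℤ) (K := ℚ)).mp hI
    exact ⟨N, by simpa using hN⟩
  have hN0 : N ≠ 0 := by
    intro h0
    have : Algebra.norm ℚ x = 0 := by rw [← hN, h0]; simp
    exact (Algebra.norm_ne_zero_iff.mpr hx) this
  have hprod : ∏ σ : K →ₐ[ℚ] ℂ, σ x = (N : ℂ) := by
    rw [← Algebra.norm_eq_prod_embeddings ℚ ℂ x, ← hN]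
    simp
  have h1 : 1 ≤ ∏ σ : K →ₐ[ℚ] ℂ, ‖σ x‖ := by
    rw [← norm_prod, hprod, Complex.norm_intCast]
    exact_mod_cast Int.one_le_abs hN0
  -- split off the inclusion `K ⊂ ℂ`
  set v : K →ₐ[ℚ] ℂ := IntermediateField.val K with hv
  have hvx : ‖v x‖ = ‖(x : ℂ)‖ := rfl
  have hsplit : ∏ σ : K →ₐ[ℚ] ℂ, ‖σ x‖ = ‖v x‖ * ∏ σ ∈ univ.erase v, ‖σ x‖ :=
    (mul_prod_erase (univ : Finset (K →ₐ[ℚ] ℂ)) (fun σ => ‖σ x‖) (mem_univ v)).symm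
  have hcard : Fintype.card (K →ₐ[ℚ] ℂ) = Module.finrank ℚ K := AlgHom.card ℚ K ℂ
  have hrest : ∏ σ ∈ univ.erase v, ‖σ x‖ ≤ B ^ (Module.finrank ℚ K - 1) := by
    calc ∏ σ ∈ univ.erase v, ‖σ x‖ ≤ ∏ _σ ∈ univ.erase v, B :=
          prod_le_prod (fun σ _ => norm_nonneg _) fun σ _ => hσ σ
      _ = B ^ (Module.finrank ℚ K - 1) := by
          rw [prod_const, card_erase_of_mem (mem_univ v), card_univ, hcard]
  calc (1 : ℝ) ≤ ∏ σ : K →ₐ[ℚ] ℂ, ‖σ x‖ := h1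
    _ = ‖v x‖ * ∏ σ ∈ univ.erase v, ‖σ x‖ := hsplit
    _ ≤ ‖(x : ℂ)‖ * B ^ (Module.finrank ℚ K - 1) := by
        rw [hvx]; exact mul_le_mul_of_nonneg_left hrest (norm_nonneg _)

end SiegelShidlovskii

end Literature.Barriers.Schanuel

end
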